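import Mathlib.Algebra.DirectSum.Module
import Mathlib.LinearAlgebra.Dual.Lemmas
import Mathlib.Order.SupIndep
import Literature.Algebra.Lie.LefschetzModuleOrthogonalComplement
import HarnessLib

/-!
# The perpendicular decomposition of a Lefschetz module with a non-degenerate invariant form (Looijenga–Lunts 1997, §1 (1.3))

Topic `Literature/Algebra/Lie` (namespace `Literature.Algebra.Lie`).  Lane `lit-hodgefound` (Track 2 foundations
library), skeleton seat `lit-hodgefound-skel-1` (generation 43), row **A1-127** (v2 = the resubmission of p543859 after review: §1b, §4 and the IRREDUCIBLE, PERFECTLY PAIRED partner in the pair type are what the review asked for) of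
`run/shared/lean/pub/lit-hodgefound/SKELETON.md`: the second half of the third sentence of Looijenga–Lunts' (1.3),
ASSEMBLED — on top of the engine A1-126 (`LefschetzModuleOrthogonalComplement.lean`) — by induction on the dimension:
for a Lefschetz module `(𝔞, M)` (A1-88) with a non-degenerate reflexive invariant form `φ`, `M` is the supremum of a
finite, pairwise `φ`-orthogonal family of `𝔤(𝔞, M)`-stable subspaces on each of which `φ` is non-degenerate, each
member being either IRREDUCIBLE (a minimal non-zero stable subspace: "irreducible orthogonal / irreducible
symplectic", cf. A1-120 / A1-124 for the dichotomy) or of PAIR TYPE `U ⊕ C` with `U` irreducible and totally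
isotropic and `C` an IRREDUCIBLE stable partner perfectly paired with `U` by `φ`, `finrank C = finrank U` ("the
direct sum of an irreducible Lefschetz module with its dual"); and (§4) the family is INDEPENDENT, i.e. an internal
direct sum ("perpendicular DIRECT sum").  The proof is
the standard one (not printed in the source): pick a minimal stable `N ≤ W`; by A1-126 §2 `φ|_N` is non-degenerate or
zero; split off `N` (resp. `N ⊕ C`, §1 relative isotropic step, via Weyl's complete reducibility from the tree)
perpendicularly inside `W` (§1 relative splitting, modular law) and recurse on `W ∩ S^⊥`.  THEOREMS ONLY; no definition,
no named fact, no `sorry` (D-0026 net debt `0`).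

## Source, VERBATIM

E. Looijenga, V. A. Lunts, *A Lie algebra attached to a projective variety*, Invent. Math. **129** (1997) 361–412,
§1 (1.3) (held TeX text `paper:arxiv-alg-geom_9604014`, p0005 L9–L16):

> "If `φ` is nondegenerate and symmetric (resp. skew-symmetric), then we call `(M, φ)` an orthogonal
> (resp. symplectic) representation. Since a nonzero invariant bilinear form on an irreducible representation is
> either orthogonal or symplectic, any Lefschetz module with nondegenerate bilinear form is the perpendicular direct
> sum of Lefschetz modules that are irreducible orthogonal, irreducible symplectic, or the direct sum of an
> irreducible Lefschetz module with its dual."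

## Rendering (dictionary)

As in A1-126: stable subspace = `Submodule K M` mapped into itself by every `x ∈ 𝔤(𝔞, M)`; irreducible stable
subspace = non-zero with no stable subspaces other than `⊥` and itself; invariant form = `φ.IsSkewAdjoint h` and
`φ.IsSkewAdjoint a` (`a ∈ 𝔞`); "perpendicular" = pairwise `φ(N, N') = 0`; `φ.IsRefl` assumed (the source's forms
are symmetric or skew); "direct sum … with its dual" = pair type `U ⊕ C`, `U` irreducible isotropic, `C` stable,
`C` irreducible, `U ∩ C = 0`, `φ` non-degenerate on `U ⊕ C`, `finrank C = finrank U`, `{c ∈ C | φ(U, c) = 0} = 0` (so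
that `φ` is a perfect `𝔤(𝔞, M)`-invariant pairing `U × C → K`, i.e. `C ≅ U^*` as a `𝔤(𝔞, M)`-module; the isomorphism
itself is left implicit).

## Contents (all proved)

* §1 **`restrict_inf_orthogonal_nondegenerate`** (relative splitting inside `W`: `W = N ⊕ (W ∩ N^⊥)`, `φ` non-degenerate
  on `W ∩ N^⊥`; modular law), **`IsLefschetzModule.exists_stable_partner_of_isotropic`** (relative isotropic step:
  stable `C ≤ W`, `N ∩ C = 0`, `φ|_{N ⊕ C}` non-degenerate; Weyl).
* §1b **`IsLefschetzModule.exists_irreducible_partner_of_isotropic`** (for `N` irreducible isotropic the partner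
  can be taken IRREDUCIBLE, with `finrank C = finrank N` and `φ : N × C → K` perfect — `C ≅ N^*`).
* §2 `exists_minimal_stable` (a non-zero stable subspace contains a minimal one; `Nat.find` on the dimension).
* §3 **`IsLefschetzModule.exists_orthogonal_decomposition_of_le`** (the decomposition of any stable `W` with `φ|_W`
  non-degenerate, by strong induction on `finrank W`) and **`IsLefschetzModule.exists_orthogonal_decomposition`**
  (`W = M`: the printed statement).
* §4 **`supIndep_of_pairwise_orthogonal`** (pairwise orthogonal + non-degenerate restrictions ⟹ `Finset.SupIndep`)
  and **`IsLefschetzModule.exists_isInternal_orthogonal_decomposition`** (the decomposition as a `DirectSum.IsInternal`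
  family: "perpendicular DIRECT sum").

## SCOPE

(a) The summands of pair type are recorded as `U ⊕ C` with `U`, `C` irreducible stable, `U` isotropic, `U ∩ C = 0`,
`φ|_{U ⊕ C}` non-degenerate, `finrank C = finrank U` and trivial right kernel `{c ∈ C | φ(U, c) = 0} = 0` (with the
isotropy of `U` and the non-degeneracy on `U ⊕ C` the left kernel is trivial too: a perfect invariant pairing
`U × C → K`); the induced module isomorphism `C ≅ U^*` is not written out as a `LinearEquiv`.  (b) The family is
independent (§4, `DirectSum.IsInternal`).  (c) "orthogonal or symplectic" for the
irreducible summands: A1-120 (`[IsAlgClosed K]`), A1-124 (line `𝔞`).  (d) Nothing here concerns complex tori or the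
Hodge conjecture.

## References

* [LooijengaLunts1997] E. Looijenga, V. A. Lunts, *A Lie algebra attached to a projective variety*, Invent. Math. 129
  (1997) 361–412; arXiv:alg-geom/9604014. §1 (1.3), p. 5 L9–L16 of the held TeX text; (1.2) p. 4 (complete
  reducibility).
-/

namespace Literature.Algebra.Lie

open Module Function Set
open LinearMap (BilinForm)

-- The commutator Lie ring of `𝔤𝔩(M) = Module.End K M`: Mathlib's reducible NON-instance, enabled file-locally
-- exactly as in `LefschetzModule.lean`.
attribute [local instance 100] LieRing.ofAssociativeRing

/-! ### §1 Relative splitting inside a stable subspace `W` with `φ|_W` non-degenerate -/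

section Relative

variable {K : Type*} [Field K] [CharZero K] {M : Type*} [AddCommGroup M] [Module K M] [FiniteDimensional K M]
  {B : BilinForm K M} {h : Module.End K M} {𝔞 : Submodule K (Module.End K M)} {W N : Submodule K M}

omit [CharZero K] in
/-- **Relative perpendicular splitting.**  Inside a subspace `W` on which the reflexive form `φ` is non-degenerate, a
subspace `N ≤ W` with `φ|_N` non-degenerate splits `W` perpendicularly: `W = N ⊕ (W ∩ N^⊥)` and `φ` is again
non-degenerate on `W ∩ N^⊥`. [cite: LooijengaLunts1997, §1 (1.3) p0005 L11–L16 ("perpendicular direct sum")] -/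
theorem restrict_inf_orthogonal_nondegenerate (hr : B.IsRefl) (hW : (B.restrict W).Nondegenerate) (hNW : N ≤ W)
    (hN : (B.restrict N).Nondegenerate) :
    N ⊔ (W ⊓ B.orthogonal N) = W ∧ N ⊓ (W ⊓ B.orthogonal N) = ⊥ ∧
      (B.restrict (W ⊓ B.orthogonal N)).Nondegenerate := by
  have hc : IsCompl N (B.orthogonal N) := LinearMap.BilinForm.isCompl_orthogonal_of_restrict_nondegenerate hr hN
  have hsup : N ⊔ (W ⊓ B.orthogonal N) = W := by
    rw [sup_comm, inf_sup_assoc_of_le (B.orthogonal N) hNW, sup_comm, hc.sup_eq_top, inf_top_eq]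
  have hinf : N ⊓ (W ⊓ B.orthogonal N) = ⊥ := by
    rw [eq_bot_iff, ← hc.inf_eq_bot]
    exact le_inf inf_le_left (inf_le_right.trans inf_le_right)
  refine ⟨hsup, hinf, ?_⟩
  -- `φ(z, ·)` vanishing on `W ∩ N^⊥` vanishes on `N` too (reflexivity), hence on `W`
  have key : ∀ z ∈ W ⊓ B.orthogonal N, (∀ w ∈ W ⊓ B.orthogonal N, B z w = 0) → z = 0 := by
    intro z hz hzw
    have hzW : ∀ w ∈ W, B z w = 0 := by
      intro w hw
      rw [← hsup] at hw
      obtain ⟨n, hn, w', hw', rfl⟩ := Submodule.mem_sup.1 hw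
      have h1 : B z n = 0 := hr n z ((LinearMap.BilinForm.mem_orthogonal_iff.1 hz.2) n hn)
      rw [map_add, h1, hzw w' hw', zero_add]
    have := hW.1 ⟨z, hz.1⟩ fun w ↦ hzW w w.2
    exact congrArg Subtype.val this
  exact ⟨fun z hz ↦ Subtype.ext (key z z.2 fun w hw ↦ hz ⟨w, hw⟩),
    fun z hz ↦ Subtype.ext (key z z.2 fun w hw ↦ hr _ _ (hz ⟨w, hw⟩))⟩

/-- **Relative isotropic step.**  In a Lefschetz module with a reflexive invariant form `φ`, inside a stable `W`
with `φ|_W` non-degenerate, an isotropic stable `N ≤ W` has a stable partner `C ≤ W` with `N ∩ C = 0` and `φ`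
non-degenerate on `N ⊕ C` (`C = W ∩ C₀` for a Weyl complement `C₀` of the stable subspace `W ∩ N^⊥` — the tree's
`exists_isCompl_lieSubmodule_of_isSemisimple`; "the direct sum of an irreducible Lefschetz module with its dual").
[cite: LooijengaLunts1997, §1 (1.3) p0005 L11–L16] [cite: LooijengaLunts1997, §1 (1.2) p0004 L65–L68] -/
theorem IsLefschetzModule.exists_stable_partner_of_isotropic (A : IsLefschetzModule K h 𝔞) (hr : B.IsRefl)
    (hh : B.IsSkewAdjoint h) (h𝔞 : ∀ a ∈ 𝔞, B.IsSkewAdjoint a)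
    (hWs : ∀ x ∈ lefschetzLieAlgebra K h 𝔞, ∀ w ∈ W, x w ∈ W) (hW : (B.restrict W).Nondegenerate) (hNW : N ≤ W)
    (hNs : ∀ x ∈ lefschetzLieAlgebra K h 𝔞, ∀ n ∈ N, x n ∈ N) (hiso : ∀ x ∈ N, ∀ y ∈ N, B x y = 0) :
    ∃ C : Submodule K M, C ≤ W ∧ (∀ x ∈ lefschetzLieAlgebra K h 𝔞, ∀ c ∈ C, x c ∈ C) ∧ N ⊓ C = ⊥ ∧
      (B.restrict (N ⊔ C)).Nondegenerate := by
  classical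
  haveI := A.isSemisimple
  haveI : FiniteDimensional K (lefschetzLieAlgebra K h 𝔞) :=
    inferInstanceAs (FiniteDimensional K (lefschetzLieAlgebra K h 𝔞).toSubmodule)
  -- the stable subspace `W ∩ N^⊥` and a Weyl complement `C₀` of it in `M`
  have hPs : ∀ x ∈ lefschetzLieAlgebra K h 𝔞, ∀ m ∈ W ⊓ B.orthogonal N, x m ∈ W ⊓ B.orthogonal N :=
    fun x hx m hm ↦ ⟨hWs x hx m hm.1, orthogonal_stable hh h𝔞 hNs x hx m hm.2⟩
  let P : LieSubmodule K (lefschetzLieAlgebra K h 𝔞) M :=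
    { W ⊓ B.orthogonal N with
      lie_mem := fun {x m} hm ↦ by
        rw [LieSubalgebra.coe_bracket_of_module, Module.End.lie_apply]
        exact hPs x.1 x.2 m hm }
  obtain ⟨C₀, hPC₀⟩ := exists_isCompl_lieSubmodule_of_isSemisimple (k := K) P
  have hC₀ : ∀ x ∈ lefschetzLieAlgebra K h 𝔞, ∀ c ∈ (C₀ : Submodule K M), x c ∈ (C₀ : Submodule K M) := by
    intro x hx c hc
    have h1 := C₀.lie_mem (x := ⟨x, hx⟩) hc
    rwa [LieSubalgebra.coe_bracket_of_module, Module.End.lie_apply] at h1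
  have hinf : (W ⊓ B.orthogonal N) ⊓ (C₀ : Submodule K M) = ⊥ := by
    have := hPC₀.inf_eq_bot
    rw [← LieSubmodule.toSubmodule_inj, LieSubmodule.inf_toSubmodule, LieSubmodule.bot_toSubmodule] at this
    exact this
  have hsup : (W ⊓ B.orthogonal N) ⊔ (C₀ : Submodule K M) = ⊤ := by
    have := hPC₀.sup_eq_top
    rw [← LieSubmodule.toSubmodule_inj, LieSubmodule.sup_toSubmodule, LieSubmodule.top_toSubmodule] at this
    exact this
  -- `C = W ∩ C₀`; by the modular law `(W ∩ N^⊥) + C = W`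
  have hsupW : (W ⊓ (C₀ : Submodule K M)) ⊔ (W ⊓ B.orthogonal N) = W := by
    rw [inf_sup_assoc_of_le (C₀ : Submodule K M) (inf_le_left : W ⊓ B.orthogonal N ≤ W), sup_comm, hsup, inf_top_eq]
  have hNle : N ≤ W ⊓ B.orthogonal N := by
    refine le_inf hNW fun y hy ↦ ?_
    rw [LinearMap.BilinForm.mem_orthogonal_iff]
    exact fun n hn ↦ hiso n hn y hy
  refine ⟨W ⊓ (C₀ : Submodule K M), inf_le_left, fun x hx c hc ↦ ⟨hWs x hx c hc.1, hC₀ x hx c hc.2⟩, ?_, ?_⟩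
  · rw [eq_bot_iff, ← hinf]
    exact le_inf (inf_le_left.trans hNle) (inf_le_right.trans inf_le_right)
  · -- non-degeneracy of `φ` on `N ⊕ C`
    have key : ∀ z ∈ N ⊔ W ⊓ (C₀ : Submodule K M), (∀ w ∈ N ⊔ W ⊓ (C₀ : Submodule K M), B z w = 0) → z = 0 := by
      intro z hz hzw
      obtain ⟨n, hn, c, hc, rfl⟩ := Submodule.mem_sup.1 hz
      -- `c ∈ (W ∩ N^⊥) ∩ C₀ = 0`
      have hc0 : c = 0 := by
        have hc' : c ∈ B.orthogonal N := by
          rw [LinearMap.BilinForm.mem_orthogonal_iff]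
          intro m hm
          have h1 := hzw m (Submodule.mem_sup_left hm)
          rw [map_add, LinearMap.add_apply, hiso n hn m hm, zero_add] at h1
          exact hr c m h1
        have : c ∈ (W ⊓ B.orthogonal N) ⊓ (C₀ : Submodule K M) := ⟨⟨hc.1, hc'⟩, hc.2⟩
        rw [hinf, Submodule.mem_bot] at this
        exact this
      subst hc0
      rw [add_zero]
      -- `φ(n, ·)` vanishes on `W ∩ N^⊥` and on `C`, hence on `W`; and `n ∈ W`
      have hnW : ∀ w ∈ W, B n w = 0 := by
        intro w hw
        rw [← hsupW] at hw
        obtain ⟨w₁, hw₁, w₂, hw₂, rfl⟩ := Submodule.mem_sup.1 hw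
        have h1 : B n w₁ = 0 := by
          have := hzw w₁ (Submodule.mem_sup_right hw₁)
          rwa [add_zero] at this
        have h2 : B n w₂ = 0 := (LinearMap.BilinForm.mem_orthogonal_iff.1 hw₂.2) n hn
        rw [map_add, h1, h2, add_zero]
      have := hW.1 ⟨n, hNW hn⟩ fun w ↦ hnW w w.2
      exact congrArg Subtype.val this
    exact ⟨fun z hz ↦ Subtype.ext (key z z.2 fun w hw ↦ hz ⟨w, hw⟩),
      fun z hz ↦ Subtype.ext (key z z.2 fun w hw ↦ hr _ _ (hz ⟨w, hw⟩))⟩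

end Relative

/-! ### §1b An IRREDUCIBLE partner: "the direct sum of an irreducible Lefschetz module with its dual" -/

section IrreduciblePartner

variable {K : Type*} [Field K] [CharZero K] {M : Type*} [AddCommGroup M] [Module K M] [FiniteDimensional K M]
  {B : BilinForm K M} {h : Module.End K M} {𝔞 : Submodule K (Module.End K M)} {W N : Submodule K M}

/-- **Irreducible partner of an irreducible isotropic stable subspace.**  In the situation of
`exists_stable_partner_of_isotropic` with `N` IRREDUCIBLE (minimal non-zero stable), the partner can be taken
irreducible as well, and then `φ` is a PERFECT `𝔤(𝔞, M)`-invariant pairing `N × C → K` (`finrank C = finrank N`), i.e.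
`C ≅ N^*`: "the direct sum of an irreducible Lefschetz module with its dual".  Construction: from any stable partner
`C₁` (§1), `D = C₁ ∩ N^⊥ ≠ C₁` is stable, `C = C₁ ∩ C₀` for a Weyl complement `C₀` of `D`; the annihilators in `N` of
non-zero stable subspaces of `C` are stable and proper, hence zero (irreducibility of `N`), and a dimension count
(`N ↪ C'^*`, `C ↪ N^*`) gives `finrank C' ≥ finrank N = finrank C` for every non-zero stable `C' ≤ C`. [cite: LooijengaLunts1997, §1 (1.3) p0005 L11–L16] [cite: LooijengaLunts1997, §1 (1.2) p0004 L65–L68] -/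
theorem IsLefschetzModule.exists_irreducible_partner_of_isotropic (A : IsLefschetzModule K h 𝔞) (hr : B.IsRefl)
    (hh : B.IsSkewAdjoint h) (h𝔞 : ∀ a ∈ 𝔞, B.IsSkewAdjoint a)
    (hWs : ∀ x ∈ lefschetzLieAlgebra K h 𝔞, ∀ w ∈ W, x w ∈ W) (hW : (B.restrict W).Nondegenerate) (hNW : N ≤ W)
    (hNs : ∀ x ∈ lefschetzLieAlgebra K h 𝔞, ∀ n ∈ N, x n ∈ N) (hN0 : N ≠ ⊥)
    (hNmin : ∀ N' : Submodule K M, N' ≤ N →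
      (∀ x ∈ lefschetzLieAlgebra K h 𝔞, ∀ n ∈ N', x n ∈ N') → N' = ⊥ ∨ N' = N)
    (hiso : ∀ x ∈ N, ∀ y ∈ N, B x y = 0) :
    ∃ C : Submodule K M, C ≤ W ∧ (∀ x ∈ lefschetzLieAlgebra K h 𝔞, ∀ c ∈ C, x c ∈ C) ∧ N ⊓ C = ⊥ ∧
      (B.restrict (N ⊔ C)).Nondegenerate ∧ C ≠ ⊥ ∧
      (∀ C' : Submodule K M, C' ≤ C → (∀ x ∈ lefschetzLieAlgebra K h 𝔞, ∀ c ∈ C', x c ∈ C') → C' = ⊥ ∨ C' = C) ∧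
      finrank K C = finrank K N ∧ (∀ u ∈ N, (∀ c ∈ C, B u c = 0) → u = 0) ∧ (∀ c ∈ C, (∀ u ∈ N, B u c = 0) → c = 0) := by
  classical
  haveI := A.isSemisimple
  haveI : FiniteDimensional K (lefschetzLieAlgebra K h 𝔞) :=
    inferInstanceAs (FiniteDimensional K (lefschetzLieAlgebra K h 𝔞).toSubmodule)
  obtain ⟨C₁, hC₁W, hC₁s, hNC₁, hnd₁⟩ := A.exists_stable_partner_of_isotropic hr hh h𝔞 hWs hW hNW hNs hiso
  -- `D = C₁ ∩ N^⊥` is stable and `≠ C₁`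
  have hDs : ∀ x ∈ lefschetzLieAlgebra K h 𝔞, ∀ d ∈ C₁ ⊓ B.orthogonal N, x d ∈ C₁ ⊓ B.orthogonal N :=
    fun x hx d hd ↦ ⟨hC₁s x hx d hd.1, orthogonal_stable hh h𝔞 hNs x hx d hd.2⟩
  have hDne : C₁ ⊓ B.orthogonal N ≠ C₁ := by
    intro hD
    -- then `φ(N, C₁) = 0`, so `φ(n, N ⊔ C₁) = 0` for `n ∈ N`, forcing `N = ⊥`
    apply hN0
    rw [eq_bot_iff]
    intro n hn
    have h1 : ∀ w ∈ N ⊔ C₁, B n w = 0 := by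
      intro w hw
      obtain ⟨a, ha, c, hc, rfl⟩ := Submodule.mem_sup.1 hw
      have hc' : c ∈ B.orthogonal N := (hD.symm ▸ hc : c ∈ C₁ ⊓ B.orthogonal N).2
      rw [map_add, hiso n hn a ha, (LinearMap.BilinForm.mem_orthogonal_iff.1 hc') n hn, add_zero]
    have := hnd₁.1 ⟨n, Submodule.mem_sup_left hn⟩ fun w ↦ h1 w w.2
    rw [Submodule.mem_bot]
    exact congrArg Subtype.val this
  -- a stable complement `C` of `D` inside `C₁` (Weyl in `M` + modular law)
  let P : LieSubmodule K (lefschetzLieAlgebra K h 𝔞) M :=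
    { C₁ ⊓ B.orthogonal N with
      lie_mem := fun {x m} hm ↦ by
        rw [LieSubalgebra.coe_bracket_of_module, Module.End.lie_apply]
        exact hDs x.1 x.2 m hm }
  obtain ⟨C₀, hPC₀⟩ := exists_isCompl_lieSubmodule_of_isSemisimple (k := K) P
  have hC₀ : ∀ x ∈ lefschetzLieAlgebra K h 𝔞, ∀ c ∈ (C₀ : Submodule K M), x c ∈ (C₀ : Submodule K M) := by
    intro x hx c hc
    have h1 := C₀.lie_mem (x := ⟨x, hx⟩) hc
    rwa [LieSubalgebra.coe_bracket_of_module, Module.End.lie_apply] at h1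
  have hinf : (C₁ ⊓ B.orthogonal N) ⊓ (C₀ : Submodule K M) = ⊥ := by
    have := hPC₀.inf_eq_bot
    rw [← LieSubmodule.toSubmodule_inj, LieSubmodule.inf_toSubmodule, LieSubmodule.bot_toSubmodule] at this
    exact this
  have hsup : (C₁ ⊓ B.orthogonal N) ⊔ (C₀ : Submodule K M) = ⊤ := by
    have := hPC₀.sup_eq_top
    rw [← LieSubmodule.toSubmodule_inj, LieSubmodule.sup_toSubmodule, LieSubmodule.top_toSubmodule] at this
    exact this
  have hsupC : (C₁ ⊓ (C₀ : Submodule K M)) ⊔ (C₁ ⊓ B.orthogonal N) = C₁ := by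
    rw [inf_sup_assoc_of_le (C₀ : Submodule K M) (inf_le_left : C₁ ⊓ B.orthogonal N ≤ C₁), sup_comm, hsup,
      inf_top_eq]
  -- `C := C₁ ∩ C₀`
  set C : Submodule K M := C₁ ⊓ (C₀ : Submodule K M) with hCdef
  have hCs : ∀ x ∈ lefschetzLieAlgebra K h 𝔞, ∀ c ∈ C, x c ∈ C := fun x hx c hc ↦ ⟨hC₁s x hx c hc.1, hC₀ x hx c hc.2⟩
  have hCD : C ⊓ B.orthogonal N = ⊥ := by
    rw [eq_bot_iff, ← hinf]
    exact le_inf (le_inf (inf_le_left.trans inf_le_left) inf_le_right) (inf_le_left.trans inf_le_right)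
  -- right non-degeneracy of the pairing `N × C`: `c ∈ C`, `φ(N, c) = 0` ⟹ `c ∈ C ∩ N^⊥ = 0`
  have hright : ∀ c ∈ C, (∀ u ∈ N, B u c = 0) → c = 0 := by
    intro c hc hc0
    have : c ∈ C ⊓ B.orthogonal N := ⟨hc, (LinearMap.BilinForm.mem_orthogonal_iff).2 hc0⟩
    rw [hCD, Submodule.mem_bot] at this
    exact this
  have hC0 : C ≠ ⊥ := by
    intro h0
    apply hDne
    have := hsupC
    rw [h0, bot_sup_eq] at this
    exact this
  -- left non-degeneracy against any non-zero stable `C' ≤ C`: the annihilator of `C'` in `N` is stable and `≠ N`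
  have hleft : ∀ C' : Submodule K M, C' ≤ C → (∀ x ∈ lefschetzLieAlgebra K h 𝔞, ∀ c ∈ C', x c ∈ C') → C' ≠ ⊥ →
      ∀ u ∈ N, (∀ c ∈ C', B u c = 0) → u = 0 := by
    intro C' hC'C hC's hC'0 u hu huc
    -- by reflexivity the annihilator `{u ∈ N | φ(u, C') = 0}` is `N ∩ C'^⊥`, a stable subspace of `N`
    have hmem : u ∈ N ⊓ B.orthogonal C' :=
      ⟨hu, (LinearMap.BilinForm.mem_orthogonal_iff).2 fun c hc ↦ hr _ _ (huc c hc)⟩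
    rcases hNmin (N ⊓ B.orthogonal C') inf_le_left
        (fun x hx v hv ↦ ⟨hNs x hx v hv.1, orthogonal_stable hh h𝔞 hC's x hx v hv.2⟩) with h1 | h1
    · rw [h1, Submodule.mem_bot] at hmem
      exact hmem
    · -- then `φ(N, C') = 0`, so `C' ≤ C ∩ N^⊥ = 0`
      exfalso
      apply hC'0
      rw [eq_bot_iff, ← hCD]
      refine le_inf hC'C fun c hc ↦ (LinearMap.BilinForm.mem_orthogonal_iff).2 fun n hn ↦ ?_
      have hn' : n ∈ N ⊓ B.orthogonal C' := h1.symm ▸ hn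
      exact hr _ _ ((LinearMap.BilinForm.mem_orthogonal_iff.1 hn'.2) c hc)
  -- dimension count: `N ↪ C'^*` for every non-zero stable `C' ≤ C`, and `C ↪ N^*`
  have hdimle : ∀ C' : Submodule K M, C' ≤ C → (∀ x ∈ lefschetzLieAlgebra K h 𝔞, ∀ c ∈ C', x c ∈ C') → C' ≠ ⊥ →
      finrank K N ≤ finrank K C' := by
    intro C' hC'C hC's hC'0
    let f : N →ₗ[K] Module.Dual K C' := B.compl₁₂ N.subtype C'.subtype
    have hf : Function.Injective f := by
      rw [← LinearMap.ker_eq_bot, eq_bot_iff]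
      intro u hu
      rw [LinearMap.mem_ker] at hu
      rw [Submodule.mem_bot]
      refine Subtype.ext (hleft C' hC'C hC's hC'0 u u.2 fun c hc ↦ ?_)
      have := LinearMap.congr_fun hu ⟨c, hc⟩
      simpa [f] using this
    calc finrank K N ≤ finrank K (Module.Dual K C') := LinearMap.finrank_le_finrank_of_injective hf
      _ = finrank K C' := Subspace.dual_finrank_eq
  have hdimge : finrank K C ≤ finrank K N := by
    let g : C →ₗ[K] Module.Dual K N := B.flip.compl₁₂ C.subtype N.subtype
    have hg : Function.Injective g := by
      rw [← LinearMap.ker_eq_bot, eq_bot_iff]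
      intro c hc
      rw [LinearMap.mem_ker] at hc
      rw [Submodule.mem_bot]
      refine Subtype.ext (hright c c.2 fun u hu ↦ ?_)
      have := LinearMap.congr_fun hc ⟨u, hu⟩
      simpa [g] using this
    calc finrank K C ≤ finrank K (Module.Dual K N) := LinearMap.finrank_le_finrank_of_injective hg
      _ = finrank K N := Subspace.dual_finrank_eq
  have hdim : finrank K C = finrank K N := le_antisymm hdimge (hdimle C le_rfl hCs hC0)
  -- non-degeneracy on `N ⊔ C`
  have hNC : N ⊓ C = ⊥ := by
    rw [eq_bot_iff, ← hNC₁]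
    exact inf_le_inf_left _ inf_le_left
  have hndNC : (B.restrict (N ⊔ C)).Nondegenerate := by
    have key : ∀ z ∈ N ⊔ C, (∀ w ∈ N ⊔ C, B z w = 0) → (∀ w ∈ N ⊔ C, B w z = 0) → z = 0 := by
      intro z hz hzl hzr
      obtain ⟨n, hn, c, hc, rfl⟩ := Submodule.mem_sup.1 hz
      have hc0 : c = 0 := hright c hc fun u hu ↦ by
        have h1 := hzr u (Submodule.mem_sup_left hu)
        rw [map_add, hiso u hu n hn, zero_add] at h1
        exact h1
      subst hc0
      rw [add_zero]
      refine hleft C le_rfl hCs hC0 n hn fun c' hc' ↦ ?_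
      have := hzl c' (Submodule.mem_sup_right hc')
      rwa [add_zero] at this
    refine ⟨fun z hz ↦ Subtype.ext (key z z.2 (fun w hw ↦ hz ⟨w, hw⟩) fun w hw ↦ hr _ _ (hz ⟨w, hw⟩)),
      fun z hz ↦ Subtype.ext (key z z.2 (fun w hw ↦ hr _ _ (hz ⟨w, hw⟩)) fun w hw ↦ hz ⟨w, hw⟩)⟩
  refine ⟨C, inf_le_left.trans hC₁W, hCs, hNC, hndNC, hC0, fun C' hC'C hC's ↦ ?_, hdim,
    hleft C le_rfl hCs hC0, hright⟩
  -- irreducibility of `C` by the dimension count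
  by_cases hC'0 : C' = ⊥
  · exact Or.inl hC'0
  · right
    exact Submodule.eq_of_le_of_finrank_le hC'C (hdim ▸ hdimle C' hC'C hC's hC'0)

end IrreduciblePartner

/-! ### §2 Minimal stable subspaces -/

section Minimal

variable {K : Type*} [Field K] {M : Type*} [AddCommGroup M] [Module K M] [FiniteDimensional K M]
  {h : Module.End K M} {𝔞 : Submodule K (Module.End K M)} {W : Submodule K M}

/-- A non-zero stable subspace contains a MINIMAL non-zero stable subspace (an irreducible stable subspace), by
finiteness of dimension. [cite: LooijengaLunts1997, §1 (1.2) p0004 L65–L68 ("the category of Lefschetz modules of 𝔞 is semisimple")] -/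
theorem exists_minimal_stable (hWs : ∀ x ∈ lefschetzLieAlgebra K h 𝔞, ∀ w ∈ W, x w ∈ W) (hW : W ≠ ⊥) :
    ∃ N : Submodule K M, N ≤ W ∧ N ≠ ⊥ ∧ (∀ x ∈ lefschetzLieAlgebra K h 𝔞, ∀ n ∈ N, x n ∈ N) ∧
      ∀ N' : Submodule K M, N' ≤ N → (∀ x ∈ lefschetzLieAlgebra K h 𝔞, ∀ n ∈ N', x n ∈ N') → N' = ⊥ ∨ N' = N := by
  classical
  -- minimise the dimension of a non-zero stable subspace of `W`
  let P : ℕ → Prop := fun d ↦ ∃ N : Submodule K M, N ≤ W ∧ N ≠ ⊥ ∧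
    (∀ x ∈ lefschetzLieAlgebra K h 𝔞, ∀ n ∈ N, x n ∈ N) ∧ finrank K N = d
  have hP : ∃ d, P d := ⟨finrank K W, W, le_rfl, hW, hWs, rfl⟩
  obtain ⟨N, hNW, hN0, hNs, hNd⟩ := Nat.find_spec hP
  refine ⟨N, hNW, hN0, hNs, fun N' hN'N hN's ↦ ?_⟩
  by_cases h0 : N' = ⊥
  · exact Or.inl h0
  · right
    have h1 : finrank K N ≤ finrank K N' := by
      rw [hNd]
      exact Nat.find_min' hP ⟨N', hN'N.trans hNW, h0, hN's, rfl⟩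
    exact Submodule.eq_of_le_of_finrank_eq hN'N (le_antisymm (Submodule.finrank_mono hN'N) h1)

end Minimal

/-! ### §3 The perpendicular decomposition -/

section Decomposition

variable {K : Type*} [Field K] [CharZero K] {M : Type*} [AddCommGroup M] [Module K M] [FiniteDimensional K M]
  {B : BilinForm K M} {h : Module.End K M} {𝔞 : Submodule K (Module.End K M)}

/-- **Looijenga–Lunts (1.3), third sentence, second half: "any Lefschetz module with nondegenerate bilinear form is the
perpendicular direct sum of Lefschetz modules that are irreducible orthogonal, irreducible symplectic, or the direct
sum of an irreducible Lefschetz module with its dual"** — RELATIVE form, by induction on the dimension: every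
`𝔤(𝔞, M)`-stable subspace `W` on which the reflexive invariant form `φ` is non-degenerate is the supremum of a finite,
pairwise `φ`-ORTHOGONAL family of stable subspaces, each with `φ` non-degenerate on it and each either IRREDUCIBLE
(a minimal non-zero stable subspace — "irreducible orthogonal / irreducible symplectic": A1-120, A1-124) or of PAIR
TYPE `U ⊕ C` with `U`, `C` irreducible, `U` totally isotropic, `U ∩ C = 0`, `finrank C = finrank U` and `φ(U, c) = 0 ⟹
c = 0` for `c ∈ C` — a perfect invariant pairing ("the direct sum of an irreducible Lefschetz module with its dual",
§1b).  Steps: A1-126 §2 (an irreducible stable `N` has `φ|_N` non-degenerate or zero),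
§1 above (relative splitting / relative isotropic partner), §2 above (minimal stable subspaces).
[cite: LooijengaLunts1997, §1 (1.3) p0005 L11–L16] -/
theorem IsLefschetzModule.exists_orthogonal_decomposition_of_le (A : IsLefschetzModule K h 𝔞) (hr : B.IsRefl)
    (hh : B.IsSkewAdjoint h) (h𝔞 : ∀ a ∈ 𝔞, B.IsSkewAdjoint a) (W : Submodule K M)
    (hWs : ∀ x ∈ lefschetzLieAlgebra K h 𝔞, ∀ w ∈ W, x w ∈ W) (hW : (B.restrict W).Nondegenerate) :
    ∃ s : Finset (Submodule K M), (∀ N ∈ s, N ≤ W) ∧ (⨆ N ∈ s, N) = W ∧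
      (∀ N ∈ s, ∀ N' ∈ s, N ≠ N' → ∀ x ∈ N, ∀ y ∈ N', B x y = 0) ∧
      ∀ N ∈ s, (∀ x ∈ lefschetzLieAlgebra K h 𝔞, ∀ n ∈ N, x n ∈ N) ∧ (B.restrict N).Nondegenerate ∧
        ((N ≠ ⊥ ∧ ∀ N' : Submodule K M, N' ≤ N →
            (∀ x ∈ lefschetzLieAlgebra K h 𝔞, ∀ n ∈ N', x n ∈ N') → N' = ⊥ ∨ N' = N) ∨
         ∃ U C : Submodule K M, U ⊔ C = N ∧ U ⊓ C = ⊥ ∧ U ≠ ⊥ ∧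
            (∀ x ∈ lefschetzLieAlgebra K h 𝔞, ∀ n ∈ U, x n ∈ U) ∧ (∀ x ∈ lefschetzLieAlgebra K h 𝔞, ∀ n ∈ C, x n ∈ C) ∧
            (∀ U' : Submodule K M, U' ≤ U →
              (∀ x ∈ lefschetzLieAlgebra K h 𝔞, ∀ n ∈ U', x n ∈ U') → U' = ⊥ ∨ U' = U) ∧
            (C ≠ ⊥ ∧ ∀ C' : Submodule K M, C' ≤ C →
              (∀ x ∈ lefschetzLieAlgebra K h 𝔞, ∀ n ∈ C', x n ∈ C') → C' = ⊥ ∨ C' = C) ∧ finrank K C = finrank K U ∧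
            (∀ c ∈ C, (∀ u ∈ U, B u c = 0) → c = 0) ∧
            ∀ x ∈ U, ∀ y ∈ U, B x y = 0) := by
  classical
  -- strong induction on `finrank W`
  suffices main : ∀ d : ℕ, ∀ W : Submodule K M, finrank K W = d →
      (∀ x ∈ lefschetzLieAlgebra K h 𝔞, ∀ w ∈ W, x w ∈ W) → (B.restrict W).Nondegenerate →
      ∃ s : Finset (Submodule K M), (∀ N ∈ s, N ≤ W) ∧ (⨆ N ∈ s, N) = W ∧
        (∀ N ∈ s, ∀ N' ∈ s, N ≠ N' → ∀ x ∈ N, ∀ y ∈ N', B x y = 0) ∧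
        ∀ N ∈ s, (∀ x ∈ lefschetzLieAlgebra K h 𝔞, ∀ n ∈ N, x n ∈ N) ∧ (B.restrict N).Nondegenerate ∧
          ((N ≠ ⊥ ∧ ∀ N' : Submodule K M, N' ≤ N →
              (∀ x ∈ lefschetzLieAlgebra K h 𝔞, ∀ n ∈ N', x n ∈ N') → N' = ⊥ ∨ N' = N) ∨
           ∃ U C : Submodule K M, U ⊔ C = N ∧ U ⊓ C = ⊥ ∧ U ≠ ⊥ ∧
              (∀ x ∈ lefschetzLieAlgebra K h 𝔞, ∀ n ∈ U, x n ∈ U) ∧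
              (∀ x ∈ lefschetzLieAlgebra K h 𝔞, ∀ n ∈ C, x n ∈ C) ∧
              (∀ U' : Submodule K M, U' ≤ U →
                (∀ x ∈ lefschetzLieAlgebra K h 𝔞, ∀ n ∈ U', x n ∈ U') → U' = ⊥ ∨ U' = U) ∧
              (C ≠ ⊥ ∧ ∀ C' : Submodule K M, C' ≤ C →
                (∀ x ∈ lefschetzLieAlgebra K h 𝔞, ∀ n ∈ C', x n ∈ C') → C' = ⊥ ∨ C' = C) ∧ finrank K C = finrank K U ∧
              (∀ c ∈ C, (∀ u ∈ U, B u c = 0) → c = 0) ∧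
              ∀ x ∈ U, ∀ y ∈ U, B x y = 0) from main _ W rfl hWs hW
  intro d
  induction d using Nat.strong_induction_on with
  | _ d ih =>
  intro W hd hWs hW
  by_cases hW0 : W = ⊥
  · -- nothing to decompose
    refine ⟨∅, by simp, by simp [hW0], by simp, by simp⟩
  -- a minimal non-zero stable `N ≤ W`; `φ|_N` is non-degenerate or zero (A1-126 §2)
  obtain ⟨N, hNW, hN0, hNs, hNmin⟩ := exists_minimal_stable hWs hW0
  -- the summand `S` to split off: `N` itself, or `N ⊕ C` in the isotropic case
  obtain ⟨S, hSW, hSs, hS0, hSnd, hStype⟩ : ∃ S : Submodule K M, S ≤ W ∧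
      (∀ x ∈ lefschetzLieAlgebra K h 𝔞, ∀ n ∈ S, x n ∈ S) ∧ S ≠ ⊥ ∧ (B.restrict S).Nondegenerate ∧
      ((S ≠ ⊥ ∧ ∀ N' : Submodule K M, N' ≤ S →
          (∀ x ∈ lefschetzLieAlgebra K h 𝔞, ∀ n ∈ N', x n ∈ N') → N' = ⊥ ∨ N' = S) ∨
       ∃ U C : Submodule K M, U ⊔ C = S ∧ U ⊓ C = ⊥ ∧ U ≠ ⊥ ∧
          (∀ x ∈ lefschetzLieAlgebra K h 𝔞, ∀ n ∈ U, x n ∈ U) ∧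
          (∀ x ∈ lefschetzLieAlgebra K h 𝔞, ∀ n ∈ C, x n ∈ C) ∧
          (∀ U' : Submodule K M, U' ≤ U →
            (∀ x ∈ lefschetzLieAlgebra K h 𝔞, ∀ n ∈ U', x n ∈ U') → U' = ⊥ ∨ U' = U) ∧
          (C ≠ ⊥ ∧ ∀ C' : Submodule K M, C' ≤ C →
            (∀ x ∈ lefschetzLieAlgebra K h 𝔞, ∀ n ∈ C', x n ∈ C') → C' = ⊥ ∨ C' = C) ∧ finrank K C = finrank K U ∧
          (∀ c ∈ C, (∀ u ∈ U, B u c = 0) → c = 0) ∧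
          ∀ x ∈ U, ∀ y ∈ U, B x y = 0) := by
    rcases restrict_nondegenerate_or_forall_apply_eq_zero hr hh h𝔞 hNs hNmin with hnd | hiso
    · exact ⟨N, hNW, hNs, hN0, hnd, Or.inl ⟨hN0, hNmin⟩⟩
    · obtain ⟨C, hCW, hCs, hNC, hnd, hC0, hCmin, hdim, -, hCright⟩ :=
        A.exists_irreducible_partner_of_isotropic hr hh h𝔞 hWs hW hNW hNs hN0 hNmin hiso
      refine ⟨N ⊔ C, sup_le hNW hCW, fun x hx n hn ↦ ?_, ?_, hnd,
        Or.inr ⟨N, C, rfl, hNC, hN0, hNs, hCs, hNmin, ⟨hC0, hCmin⟩, hdim, hCright, hiso⟩⟩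
      · obtain ⟨a, ha, c, hc, rfl⟩ := Submodule.mem_sup.1 hn
        rw [map_add]
        exact Submodule.add_mem _ (Submodule.mem_sup_left (hNs x hx a ha)) (Submodule.mem_sup_right (hCs x hx c hc))
      · exact fun h0 ↦ hN0 (eq_bot_iff.2 (le_sup_left.trans h0.le))
  -- split `W = S ⊕ W'`, `W' = W ∩ S^⊥`, and decompose `W'` by induction
  obtain ⟨hsupW, hinfW, hW'nd⟩ := restrict_inf_orthogonal_nondegenerate hr hW hSW hSnd
  have hW's : ∀ x ∈ lefschetzLieAlgebra K h 𝔞, ∀ w ∈ W ⊓ B.orthogonal S, x w ∈ W ⊓ B.orthogonal S :=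
    fun x hx w hw ↦ ⟨hWs x hx w hw.1, orthogonal_stable hh h𝔞 hSs x hx w hw.2⟩
  have hlt : finrank K ↥(W ⊓ B.orthogonal S) < d := by
    have h1 := Submodule.finrank_sup_add_finrank_inf_eq S (W ⊓ B.orthogonal S)
    rw [hsupW, hinfW, finrank_bot, add_zero, hd] at h1
    have h2 : 0 < finrank K S := by
      rw [Nat.pos_iff_ne_zero, Ne, Submodule.finrank_eq_zero]
      exact hS0
    omega
  obtain ⟨s', hs'le, hs'sup, hs'orth, hs'prop⟩ := ih _ hlt (W ⊓ B.orthogonal S) rfl hW's hW'nd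
  refine ⟨insert S s', ?_, ?_, ?_, ?_⟩
  · intro N' hN'
    rcases Finset.mem_insert.1 hN' with rfl | hN'
    · exact hSW
    · exact (hs'le N' hN').trans inf_le_left
  · rw [Finset.iSup_insert, hs'sup, hsupW]
  · -- pairwise orthogonality: members of `s'` lie in `S^⊥`
    have horth : ∀ N' ∈ s', ∀ x ∈ S, ∀ y ∈ N', B x y = 0 := fun N' hN' x hx y hy ↦
      (LinearMap.BilinForm.mem_orthogonal_iff.1 (hs'le N' hN' hy).2) x hx
    intro N₁ hN₁ N₂ hN₂ hne x hx y hy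
    rcases Finset.mem_insert.1 hN₁ with rfl | hN₁' <;> rcases Finset.mem_insert.1 hN₂ with rfl | hN₂'
    · exact absurd rfl hne
    · exact horth N₂ hN₂' x hx y hy
    · exact hr _ _ (horth N₁ hN₁' y hy x hx)
    · exact hs'orth N₁ hN₁' N₂ hN₂' hne x hx y hy
  · intro N' hN'
    rcases Finset.mem_insert.1 hN' with rfl | hN'
    · exact ⟨hSs, hSnd, hStype⟩
    · exact hs'prop N' hN'

/-- **The decomposition of the whole module**: for a Lefschetz module `(𝔞, M)` with a NON-DEGENERATE reflexive
invariant form `φ`, `M` is the supremum of a finite pairwise `φ`-orthogonal family of `𝔤(𝔞, M)`-stable subspaces with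
non-degenerate restrictions, each irreducible or of pair type `U ⊕ C` (`U`, `C` irreducible, `U` isotropic,
`finrank C = finrank U`, `φ : U × C → K` perfect). [cite: LooijengaLunts1997, §1 (1.3) p0005 L11–L16] -/
theorem IsLefschetzModule.exists_orthogonal_decomposition (A : IsLefschetzModule K h 𝔞) (hB : B.Nondegenerate)
    (hr : B.IsRefl) (hh : B.IsSkewAdjoint h) (h𝔞 : ∀ a ∈ 𝔞, B.IsSkewAdjoint a) :
    ∃ s : Finset (Submodule K M), (⨆ N ∈ s, N) = ⊤ ∧
      (∀ N ∈ s, ∀ N' ∈ s, N ≠ N' → ∀ x ∈ N, ∀ y ∈ N', B x y = 0) ∧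
      ∀ N ∈ s, (∀ x ∈ lefschetzLieAlgebra K h 𝔞, ∀ n ∈ N, x n ∈ N) ∧ (B.restrict N).Nondegenerate ∧
        ((N ≠ ⊥ ∧ ∀ N' : Submodule K M, N' ≤ N →
            (∀ x ∈ lefschetzLieAlgebra K h 𝔞, ∀ n ∈ N', x n ∈ N') → N' = ⊥ ∨ N' = N) ∨
         ∃ U C : Submodule K M, U ⊔ C = N ∧ U ⊓ C = ⊥ ∧ U ≠ ⊥ ∧
            (∀ x ∈ lefschetzLieAlgebra K h 𝔞, ∀ n ∈ U, x n ∈ U) ∧ (∀ x ∈ lefschetzLieAlgebra K h 𝔞, ∀ n ∈ C, x n ∈ C) ∧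
            (∀ U' : Submodule K M, U' ≤ U →
              (∀ x ∈ lefschetzLieAlgebra K h 𝔞, ∀ n ∈ U', x n ∈ U') → U' = ⊥ ∨ U' = U) ∧
            (C ≠ ⊥ ∧ ∀ C' : Submodule K M, C' ≤ C →
              (∀ x ∈ lefschetzLieAlgebra K h 𝔞, ∀ n ∈ C', x n ∈ C') → C' = ⊥ ∨ C' = C) ∧ finrank K C = finrank K U ∧
            (∀ c ∈ C, (∀ u ∈ U, B u c = 0) → c = 0) ∧
            ∀ x ∈ U, ∀ y ∈ U, B x y = 0) := by
  have htop : (B.restrict (⊤ : Submodule K M)).Nondegenerate := by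
    refine ⟨fun z hz ↦ Subtype.ext (hB.1 z fun w ↦ hz ⟨w, Submodule.mem_top⟩),
      fun z hz ↦ Subtype.ext (hB.2 z fun w ↦ hz ⟨w, Submodule.mem_top⟩)⟩
  obtain ⟨s, -, hsup, horth, hprop⟩ :=
    A.exists_orthogonal_decomposition_of_le hr hh h𝔞 ⊤ (fun _ _ _ _ ↦ Submodule.mem_top) htop
  exact ⟨s, hsup, horth, hprop⟩

end Decomposition

/-! ### §4 The family is independent: a perpendicular DIRECT sum -/

section Direct

variable {K : Type*} [Field K] [CharZero K] {M : Type*} [AddCommGroup M] [Module K M] [FiniteDimensional K M]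
  {B : BilinForm K M} {h : Module.End K M} {𝔞 : Submodule K (Module.End K M)}

omit [CharZero K] [FiniteDimensional K M] in
/-- A finite family of pairwise `φ`-orthogonal subspaces on each of which `φ` is non-degenerate is (sup-)INDEPENDENT:
an element of `N` lying in the span of the other members is `φ`-orthogonal to `N`, hence zero ("perpendicular
direct sum"). [cite: LooijengaLunts1997, §1 (1.3) p0005 L11–L16 ("perpendicular direct sum")] -/
theorem supIndep_of_pairwise_orthogonal {s : Finset (Submodule K M)}
    (horth : ∀ N ∈ s, ∀ N' ∈ s, N ≠ N' → ∀ x ∈ N, ∀ y ∈ N', B x y = 0)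
    (hnd : ∀ N ∈ s, (B.restrict N).Nondegenerate) : s.SupIndep id := by
  classical
  rw [Finset.supIndep_iff_disjoint_erase]
  intro N hN
  rw [Submodule.disjoint_def]
  intro x hxN hx'
  -- `φ(y, x) = 0` for all `y ∈ N`
  have key : ∀ y ∈ N, B y x = 0 := by
    rw [Finset.sup_eq_iSup] at hx'
    refine Submodule.iSup_induction (fun N' ↦ ⨆ (_ : N' ∈ s.erase N), id N') (motive := fun x ↦ ∀ y ∈ N, B y x = 0)
      hx' ?_ ?_ ?_
    · intro N' z hz y hy
      by_cases hN' : N' ∈ s.erase N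
      · rw [iSup_pos hN'] at hz
        obtain ⟨hne, hN's⟩ := Finset.mem_erase.1 hN'
        exact horth N hN N' hN's (Ne.symm hne) y hy z hz
      · rw [iSup_neg hN', Submodule.mem_bot] at hz
        rw [hz, map_zero]
    · intro y _
      exact map_zero _
    · intro z z' hz hz' y hy
      rw [map_add, hz y hy, hz' y hy, add_zero]
  have := (hnd N hN).2 ⟨x, hxN⟩ fun y ↦ key y y.2
  exact congrArg Subtype.val this

/-- **"perpendicular DIRECT sum"**: the decomposition of `IsLefschetzModule.exists_orthogonal_decomposition` is an
internal direct sum (`DirectSum.IsInternal`) of pairwise `φ`-orthogonal stable subspaces with non-degenerate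
restrictions, each irreducible or of pair type. [cite: LooijengaLunts1997, §1 (1.3) p0005 L11–L16] -/
theorem IsLefschetzModule.exists_isInternal_orthogonal_decomposition (A : IsLefschetzModule K h 𝔞)
    (hB : B.Nondegenerate) (hr : B.IsRefl) (hh : B.IsSkewAdjoint h) (h𝔞 : ∀ a ∈ 𝔞, B.IsSkewAdjoint a) :
    ∃ s : Finset (Submodule K M), DirectSum.IsInternal (fun N : s ↦ (N : Submodule K M)) ∧
      (∀ N ∈ s, ∀ N' ∈ s, N ≠ N' → ∀ x ∈ N, ∀ y ∈ N', B x y = 0) ∧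
      ∀ N ∈ s, (∀ x ∈ lefschetzLieAlgebra K h 𝔞, ∀ n ∈ N, x n ∈ N) ∧ (B.restrict N).Nondegenerate ∧
        ((N ≠ ⊥ ∧ ∀ N' : Submodule K M, N' ≤ N →
            (∀ x ∈ lefschetzLieAlgebra K h 𝔞, ∀ n ∈ N', x n ∈ N') → N' = ⊥ ∨ N' = N) ∨
         ∃ U C : Submodule K M, U ⊔ C = N ∧ U ⊓ C = ⊥ ∧ U ≠ ⊥ ∧
            (∀ x ∈ lefschetzLieAlgebra K h 𝔞, ∀ n ∈ U, x n ∈ U) ∧ (∀ x ∈ lefschetzLieAlgebra K h 𝔞, ∀ n ∈ C, x n ∈ C) ∧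
            (∀ U' : Submodule K M, U' ≤ U →
              (∀ x ∈ lefschetzLieAlgebra K h 𝔞, ∀ n ∈ U', x n ∈ U') → U' = ⊥ ∨ U' = U) ∧
            (C ≠ ⊥ ∧ ∀ C' : Submodule K M, C' ≤ C →
              (∀ x ∈ lefschetzLieAlgebra K h 𝔞, ∀ n ∈ C', x n ∈ C') → C' = ⊥ ∨ C' = C) ∧ finrank K C = finrank K U ∧
            (∀ c ∈ C, (∀ u ∈ U, B u c = 0) → c = 0) ∧
            ∀ x ∈ U, ∀ y ∈ U, B x y = 0) := by
  classical
  obtain ⟨s, hsup, horth, hprop⟩ := A.exists_orthogonal_decomposition hB hr hh h𝔞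
  refine ⟨s, ?_, horth, hprop⟩
  have hind : s.SupIndep id := supIndep_of_pairwise_orthogonal horth fun N hN ↦ (hprop N hN).2.1
  refine DirectSum.isInternal_submodule_of_iSupIndep_of_iSup_eq_top ?_ ?_
  · exact hind.independent
  · rw [← hsup, iSup_subtype]

end Direct

end Literature.Algebra.Lie
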